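import Summits.ResolutionOfSingularities.ResolutionOfSingularities.Theorems.HilbertSamuelEliminationSigmaMaxModificationsCorridor3WLadderIsoInsepE2Rsop
import Summits.ResolutionOfSingularities.ResolutionOfSingularities.Theorems.HilbertSamuelEliminationSigmaMaxModificationsCorridor3WLadderIsoInsepTailCutDefs
import Summits.ResolutionOfSingularities.ResolutionOfSingularities.Theorems.HilbertSamuelEliminationSigmaMaxModificationsCorridor3WLadderIsoInsepSplitMilnorFinite
import Summits.ResolutionOfSingularities.ResolutionOfSingularities.Theorems.HilbertSamuelEliminationSigmaMaxModificationsCorridor3WLadderIsoTailsEmbeddedStepStalk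
import HarnessLib

/-!
# [OURS · L1 W4.2] E2 chart calculus, bricks 6–7: THE TOWER FORM AND THE E2 STEP PRESENTATION — at every E2 stage of an isolated E3 point tower over a maximal origin of
# characteristic two the stalk has E2-adapted regular parameters `h ≡ ĉ(x² + λ̂y²) (mod 𝔪³)` (crux chain w42, cell k2 `T3insep` =
# `stub_isoInsepTower`; `--supports stmt-ResolutionOfSingularities-19249`)

OURS (cell res-hironaka, slot W4.2, seat res-D-pv-042; OWN OBJECT TUO 15:58Z); NOT a statement of [Hironaka2017] nor of
[CossartJannsenSaito2020] / [CossartPiltant2008]. AI-drafted, weaker than expert review. PROOF file, def-free, fact-free.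

* `ringKrullDim_stalk_eq_three_of_isFormalDoublePointAt` — a formal double point of embedding dimension four has a local ring of dimension `3`.
* `dirDim_eq_two_of_isE2Stage` / `geomDirDim_eq_three_of_isE2Stage` — at an E2 stage (`IsE2Stage`: inseparable, formal double point,
  `2 ≤ e`) `e = 2` and `ē = 3` (`e < ē ≤ dim 𝒪 = 3`).
* `exists_rsop_e2Shape_of_isE2Stage` — the rows' form: for `IsMaximalOrigin 2 N ν (T.X 0) (pt 0)`, `IsIsoPointTower N ν T pt` and an E2 stage
  `n`, brick 5 `exists_rsop_e2Shape_of_isFormalDoublePointAt` applies to `(T.X n, pt n)` (structure morphism over the origin's field by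
  `Moving.exists_towerStructure`): `R`, regular parameters `c : Fin 4 → R`, `σ : R ↠ 𝒪_{X_n,x_n}`, `ker σ = (h)`, `h ∈ 𝔪² ∖ 𝔪³`,
  `h − ĉ(c 0² + λ̂ c 1²) ∈ 𝔪³` — exactly the input `(c, σ, h, m = 2)` of res-type-071's `EmbeddedStep.exists_stalk_presentation_tower`.
* `exists_e2StepPresentation` (brick 7) — the same datum PUSHED THROUGH res-type-071's embedded local step
  (`IdeasL1C5.EmbeddedStep.exists_stalk_presentation_tower`, all clauses kept): a chart `j`, a prime `𝔔` of `B = R[𝔪/c_j]` over `𝔪_R`,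
  the strict transform `h′` (`h = c_j² h′`, `c_j ∤ h′`, `h′ ∈ 𝔔`) and `σ′ : B_𝔔 ↠ 𝒪_{X_{n+1},x_{n+1}}` with `ker σ′ = (h′)`, compatibly with
  `π_n`.  This is the common STARTING DATUM of the chart lemmas (N2′) «near ⇒ on the line `V(x̄,ȳ)`» and (N3) «near ⟺ `P_τ | g₃`» of the
  NJ/RC dictionary (`D/res-D-pv-042/NJ-RC-dictionary-scoping.md`): in the chart, `h′ = ĉ(u² + λ̂v²) + c_j·b`, `u = c_0/c_j`, `v = c_1/c_j`.
-/

noncomputable section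

set_option linter.dupNamespace false

open scoped Classical
open CategoryTheory AlgebraicGeometry TopologicalSpace IsLocalRing MvPowerSeries Module
open Literature.RingTheory.HilbertSamuel Literature.AlgebraicGeometry.Resolution Literature.AlgebraicGeometry.CossartJannsenSaito2020
open Summit.ResolutionOfSingularities.ResolutionOfSingularities.Theorems.CampaignW42
open Summit.ResolutionOfSingularities.ResolutionOfSingularities.Theorems.SigmaMaxModificationsCorridor3
open Summit.ResolutionOfSingularities.ResolutionOfSingularities.Theorems.SigmaMaxModificationsCorridor3.Moving (exists_towerStructure)
open Summit.ResolutionOfSingularities.ResolutionOfSingularities.Cruxes.SigmaMaxModifications.IdeasL1Idea2R4 (IsIsoPointTower)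
open Summit.ResolutionOfSingularities.ResolutionOfSingularities.Cruxes.SigmaMaxModifications.IdeasL1C5 (IsInsepStage)
open Summit.ResolutionOfSingularities.ResolutionOfSingularities.Cruxes.SigmaMaxModifications.IdeasL1C5.EmbeddedStep (exists_stalk_presentation_tower)

namespace Summit.ResolutionOfSingularities.ResolutionOfSingularities.Cruxes.SigmaMaxModifications.IdeasL1C6

/-- A formal double point of embedding dimension four has a `3`-dimensional local ring (`dim Ô = dim K⟦x,y,z,w⟧ − 1`). [folklore] -/
theorem ringKrullDim_stalk_eq_three_of_isFormalDoublePointAt {X : Scheme.{0}} [IsLocallyNoetherian X] {x : X}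
    (hdp : IsFormalDoublePointAt X x) : ringKrullDim (X.presheaf.stalk x) = (3 : ℕ) := by
  obtain ⟨κ, _, F, hF, ⟨e⟩⟩ := hdp
  haveI : IsRegularLocalRing (MvPowerSeries (Fin 4) κ) := (isRegularLocalRing_mvPowerSeries_fin κ 4).1
  have hdimS : ringKrullDim (MvPowerSeries (Fin 4) κ) = (4 : ℕ) := (isRegularLocalRing_mvPowerSeries_fin κ 4).2
  haveI : IsDomain (MvPowerSeries (Fin 4) κ) := isDomain_of_isRegularLocalRing _
  have hF0 : F ≠ 0 := by
    intro h0; rw [h0, MvPowerSeries.order_zero] at hF; exact ENat.top_ne_coe 2 hF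
  have hF𝔪 : F ∈ maximalIdeal (MvPowerSeries (Fin 4) κ) :=
    Literature.RingTheory.MvPowerSeries.Jets.mem_maximalIdeal_iff_one_le_order.mpr (by rw [hF]; norm_num)
  haveI : IsNoetherianRing (AdicCompletion (maximalIdeal (X.presheaf.stalk x)) (X.presheaf.stalk x)) :=
    isNoetherianRing_adicCompletion_maximalIdeal _
  have h1 : ringKrullDim (AdicCompletion (maximalIdeal (X.presheaf.stalk x)) (X.presheaf.stalk x)) =
      ringKrullDim (MvPowerSeries (Fin 4) κ ⧸ Ideal.span {F}) := ringKrullDim_eq_of_ringEquiv e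
  have h2 : ringKrullDim (MvPowerSeries (Fin 4) κ ⧸ Ideal.span {F}) + 1 = ringKrullDim (MvPowerSeries (Fin 4) κ) :=
    ringKrullDim_quotient_span_singleton_succ_eq_ringKrullDim_of_mem_nonZeroDivisors (mem_nonZeroDivisors_of_ne_zero hF0) hF𝔪
  rw [ringKrullDim_adicCompletion] at h1
  obtain ⟨m, hm⟩ : ∃ m : ℕ, ringKrullDim (MvPowerSeries (Fin 4) κ ⧸ Ideal.span {F}) = m := by
    haveI : IsLocalRing (MvPowerSeries (Fin 4) κ ⧸ Ideal.span {F}) := IsoTailsHS.isLocalRing_quotient_span_singleton_of_mem hF𝔪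
    haveI : IsNoetherianRing (MvPowerSeries (Fin 4) κ ⧸ Ideal.span {F}) := Ideal.Quotient.isNoetherianRing _
    exact exists_nat_cast_eq_ringKrullDim
  rw [hm, hdimS] at h2
  have h3 : m = 3 := by
    have h2' : ((m + 1 : ℕ) : WithBot ℕ∞) = ((4 : ℕ) : WithBot ℕ∞) := by push_cast; exact_mod_cast h2
    have := (Nat.cast_inj (R := WithBot ℕ∞)).mp h2'
    omega
  rw [h1, hm, h3]

/-- At an E2 stage `e = 2`. [folklore] -/
theorem dirDim_eq_two_of_isE2Stage {T : BlowupTower.{0}} {pt : ∀ n, T.X n} {n : ℕ} (hE : IsE2Stage T pt n) :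
    @Scheme.dirDim (T.X n) (T.ln n) (pt n) = 2 := by
  haveI : IsLocallyNoetherian (T.X n) := T.ln n
  obtain ⟨hins, hdp, h2⟩ := hE
  have h3 : ringKrullDim ((T.X n).presheaf.stalk (pt n)) = (3 : ℕ) := ringKrullDim_stalk_eq_three_of_isFormalDoublePointAt hdp
  have hle : (Scheme.geomDirDim (T.X n) (pt n) : WithBot ℕ∞) ≤ ringKrullDim ((T.X n).presheaf.stalk (pt n)) :=
    geomDirDim_le_ringKrullDim _
  rw [h3] at hle
  have hle' : Scheme.geomDirDim (T.X n) (pt n) ≤ 3 := by exact_mod_cast hle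
  have hlt : Scheme.dirDim (T.X n) (pt n) < Scheme.geomDirDim (T.X n) (pt n) := hins
  change 2 ≤ Scheme.dirDim (T.X n) (pt n) at h2
  omega

/-- At an E2 stage `ē = 3`. [folklore] -/
theorem geomDirDim_eq_three_of_isE2Stage {T : BlowupTower.{0}} {pt : ∀ n, T.X n} {n : ℕ} (hE : IsE2Stage T pt n) :
    @Scheme.geomDirDim (T.X n) (T.ln n) (pt n) = 3 := by
  haveI : IsLocallyNoetherian (T.X n) := T.ln n
  obtain ⟨hins, hdp, h2⟩ := hE
  have h3 : ringKrullDim ((T.X n).presheaf.stalk (pt n)) = (3 : ℕ) := ringKrullDim_stalk_eq_three_of_isFormalDoublePointAt hdp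
  have hle : (Scheme.geomDirDim (T.X n) (pt n) : WithBot ℕ∞) ≤ ringKrullDim ((T.X n).presheaf.stalk (pt n)) :=
    geomDirDim_le_ringKrullDim _
  rw [h3] at hle
  have hle' : Scheme.geomDirDim (T.X n) (pt n) ≤ 3 := by exact_mod_cast hle
  have hlt : Scheme.dirDim (T.X n) (pt n) < Scheme.geomDirDim (T.X n) (pt n) := hins
  change 2 ≤ Scheme.dirDim (T.X n) (pt n) at h2
  omega

/-- **THE TOWER FORM OF THE E2 SHAPE.** Along an isolated E3 point tower over a maximal origin of characteristic two, at every E2 stage `n`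
the stalk `𝒪_{X_n,x_n}` has a hypersurface presentation `σ : R ↠ 𝒪` from a regular local ring of embedding dimension `4` with regular
parameters `c` such that `ker σ = (h)`, `h ∈ 𝔪² ∖ 𝔪³` and `h − ĉ·(c 0² + λ̂·c 1²) ∈ 𝔪³` (`ĉ` a unit, the residue of `λ̂` not a square).
[OURS · L1 W4.2 · k2 · E2 chart calculus, brick 6] [folklore] -/
theorem exists_rsop_e2Shape_of_isE2Stage {N : ℕ} {ν : ℕ → ℕ} {T : BlowupTower.{0}} {pt : ∀ n, T.X n}
    (hO : IsMaximalOrigin 2 N ν (T.X 0) (pt 0)) (n : ℕ) (hE : IsE2Stage T pt n) :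
    ∃ (R : Type) (_ : CommRing R) (_ : IsRegularLocalRing R) (c : Fin 4 → R) (σ : R →+* (T.X n).presheaf.stalk (pt n))
      (h cc lam : R),
      (maximalIdeal R).spanFinrank = 4 ∧ Ideal.span (Set.range c) = maximalIdeal R ∧ Function.Surjective σ ∧
      RingHom.ker σ = Ideal.span {h} ∧ h ∈ maximalIdeal R ^ 2 ∧ h ∉ maximalIdeal R ^ 3 ∧
      cc ∉ maximalIdeal R ∧ (∀ u : R, u ^ 2 - lam ∉ maximalIdeal R) ∧
      h - cc * (c 0 ^ 2 + lam * c 1 ^ 2) ∈ maximalIdeal R ^ 3 := by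
  obtain ⟨k, _, _, f₀, hsep, hft, hqc⟩ := hO.exists_structure
  haveI := hsep
  haveI := hft
  haveI := hqc
  obtain ⟨f, -, hf1, -⟩ := exists_towerStructure T f₀
  haveI := hf1 n
  haveI : IsLocallyNoetherian (T.X n) := T.ln n
  exact exists_rsop_e2Shape_of_isFormalDoublePointAt (f n) (pt n) hE.2.1 (dirDim_eq_two_of_isE2Stage hE)
    (geomDirDim_eq_three_of_isE2Stage hE)

/-- **THE E2 STEP PRESENTATION.** Along an isolated E3 point tower over a maximal origin of characteristic two, at an E2 stage `n`:
E2-adapted regular parameters `c` of a regular local `R` (edim `4`) presenting `𝒪_{X_n,x_n} = R/(h)` with `h ≡ ĉ(c 0² + λ̂ c 1²) (mod 𝔪³)`,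
AND a chart `j`, a prime `𝔔` of `B = R[𝔪/c_j]` over `𝔪_R` and the strict transform `h′` (`h = c_j² h′`, `c_j ∤ h′`, `h′ ∈ 𝔔`) with
`𝒪_{X_{n+1},x_{n+1}} ≅ B_𝔔/(h′)` compatibly with `π_n` (res-type-071's embedded local step, all clauses kept). [OURS · L1 W4.2 · k2 ·
E2 chart calculus, brick 7] [folklore] -/
theorem exists_e2StepPresentation {N : ℕ} {ν : ℕ → ℕ} {T : BlowupTower.{0}} {pt : ∀ n, T.X n}
    (hO : IsMaximalOrigin 2 N ν (T.X 0) (pt 0)) (hT : IsIsoPointTower N ν T pt) (n : ℕ) (hE : IsE2Stage T pt n) :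
    ∃ (R : Type) (_ : CommRing R) (_ : IsRegularLocalRing R) (c : Fin 4 → R) (σ : R →+* (T.X n).presheaf.stalk (pt n))
      (h cc lam : R) (hpt : (T.π n) (pt (n + 1)) = pt n),
      (maximalIdeal R).spanFinrank = 4 ∧ Ideal.span (Set.range c) = maximalIdeal R ∧ Function.Surjective σ ∧
      RingHom.ker σ = Ideal.span {h} ∧ h ∈ maximalIdeal R ^ 2 ∧ h ∉ maximalIdeal R ^ 3 ∧
      cc ∉ maximalIdeal R ∧ (∀ u : R, u ^ 2 - lam ∉ maximalIdeal R) ∧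
      h - cc * (c 0 ^ 2 + lam * c 1 ^ 2) ∈ maximalIdeal R ^ 3 ∧
    ∃ (j : Fin 4) (𝔔 : PrimeSpectrum (blowupAlgebra (Ideal.span (Set.range c)) (c j)))
      (h' : blowupAlgebra (Ideal.span (Set.range c)) (c j))
      (σ' : Localization.AtPrime 𝔔.asIdeal →+* (T.X (n + 1)).presheaf.stalk (pt (n + 1))),
      algebraMap R _ h = algebraMap R _ (c j) ^ 2 * h' ∧
      Prime (algebraMap R (blowupAlgebra (Ideal.span (Set.range c)) (c j)) (c j)) ∧
      ¬ algebraMap R (blowupAlgebra (Ideal.span (Set.range c)) (c j)) (c j) ∣ h' ∧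
      𝔔.asIdeal.comap (algebraMap R _) = maximalIdeal R ∧
      h' ∈ 𝔔.asIdeal ∧
      IsRegularLocalRing (Localization.AtPrime 𝔔.asIdeal) ∧
      Function.Surjective σ' ∧
      RingHom.ker σ' = Ideal.span {algebraMap _ (Localization.AtPrime 𝔔.asIdeal) h'} ∧
      (∀ r : R, σ' (algebraMap _ (Localization.AtPrime 𝔔.asIdeal)
        (algebraMap R (blowupAlgebra (Ideal.span (Set.range c)) (c j)) r)) =
          ((T.π n).stalkMap (pt (n + 1))).hom (((T.X n).presheaf.stalkCongr (.of_eq hpt)).inv (σ r))) ∧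
      (∀ k : Fin 4, σ' (algebraMap _ (Localization.AtPrime 𝔔.asIdeal) (blowupAlgebra.frac c j k)) *
        ((T.π n).stalkMap (pt (n + 1))).hom (((T.X n).presheaf.stalkCongr (.of_eq hpt)).inv (σ (c j))) =
          ((T.π n).stalkMap (pt (n + 1))).hom (((T.X n).presheaf.stalkCongr (.of_eq hpt)).inv (σ (c k)))) ∧
      ((T.π n).stalkMap (pt (n + 1))).hom (((T.X n).presheaf.stalkCongr (.of_eq hpt)).inv (σ (c j))) ∈
        nonZeroDivisors ((T.X (n + 1)).presheaf.stalk (pt (n + 1))) ∧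
      stalkIdeal ((T.centreIdeal n).comap (T.π n)) (pt (n + 1)) =
        Ideal.span {((T.π n).stalkMap (pt (n + 1))).hom
          (((T.X n).presheaf.stalkCongr (.of_eq hpt)).inv (σ (c j)))} := by
  obtain ⟨R, _, _, c, σ, h, cc, lam, h4, hc, hσ, hker, hh2, hh3, hcc, hlam, hshape⟩ :=
    exists_rsop_e2Shape_of_isE2Stage hO n hE
  have hC : T.C n = {pt n} := hT.1 n
  have hpt : (T.π n) (pt (n + 1)) = pt n := hT.2.1 n
  have hcl : IsClosed ({pt n} : Set (T.X n)) := hT.2.2.1 n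
  obtain ⟨j, 𝔔, h', σ', H⟩ :=
    exists_stalk_presentation_tower T pt n hC hcl hpt h4 c hc σ hσ hker (m := 2) hh2 hh3
  exact ⟨R, inferInstance, inferInstance, c, σ, h, cc, lam, hpt, h4, hc, hσ, hker, hh2, hh3, hcc, hlam, hshape, j, 𝔔, h', σ', H⟩

end Summit.ResolutionOfSingularities.ResolutionOfSingularities.Cruxes.SigmaMaxModifications.IdeasL1C6

end
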